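import Literature.Probability.LatticeModels.RandomClusterFKG
import Literature.Probability.LatticeModels.RandomClusterDomainMarkov
import Literature.Probability.LatticeModels.FKIsingRSW
import Literature.Probability.Percolation.LatticeSymmetry
import HarnessLib

/-!
# Invariance of the random-cluster measure under graph isomorphisms; lattice symmetries

Topic `Literature/Probability/LatticeModels` (trunk `StatMech`). The finite-graph random-cluster
measure `φ^B_{G,p,q} = rcMeasure G p q B` (`RandomCluster.lean`; Grimmett 2006, (1.2)) is a
function of the graph structure only: a graph isomorphism `φ : G ≃g G'` carries `φ^B_{G,p,q}` to
`φ^{φ(B)}_{G',p,q}` (the weights `p^{|ω|}(1-p)^{|E∖ω|}q^{k^B(ω)}` are preserved because `φ` maps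
edge sets bijectively and induces an isomorphism of the wired open graphs). This is the step
"by translation invariance … by symmetry" used throughout Duminil-Copin–Smirnov 2012 (§3.2:
"the position of the rectangle is irrelevant") and Grimmett 2006 (§4.3, automorphism invariance),
here in H21's formalism:

* `clusterCount_relabel`, `rcWeight_relabel`, `rcPartitionFunction_relabel`,
  `rcMeasure_real_preimage_relabel` — the generic statements for `φ : G ≃g G'`, with events
  transported by `BondConfig.relabel (sym2Equiv φ)` (`ω ↦ φ '' ω`, `BondPercolationSymmetry.lean`).
* `finsetGraphIso` — an automorphism `g` of the ambient graph (`zdGraph d`) restricts to an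
  isomorphism `finsetGraph G S ≃g finsetGraph G S'` whenever `S' = g(S)`; it maps the wired
  boundary `∂S` onto `∂S'` (`image_finsetGraphIso_wiredBoundary`) and value-defined vertex sets to
  value-defined vertex sets (`image_finsetGraphIso_setOf`).
* `fkIsingFiniteMeasure_eq_finsetGraph` — the critical FK-Ising measure of `FKIsingRSW.lean` is the
  `rcMeasure` of `finsetGraph (zdGraph 2) S` (same object, `RandomClusterDomainMarkov` API), and
  `fkIsingFiniteMeasure_real_openCrossing_image` — its crossing probabilities are invariant under the
  symmetries of `ℤ²` (translations `zdShiftIso`, signed coordinate permutations `zdSignedPermIso`).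
* Consequences for DCS Thm. 3.16 (`fkIsing_rsw`, a named fact, here a hypothesis): the bound holds
  for every translate of the `4n × n` rectangle (`fkIsing_rsw.shift`) and, transposed, for
  bottom-to-top crossings of the `n × 4n` rectangle (`fkIsing_rsw.transpose_shift`).

Everything is proved; no new named facts.

## References

* G. Grimmett, *The Random-Cluster Model*, Springer (2006): §1.2 eq. (1.2); §4.3 (invariance
  under automorphisms).
* H. Duminil-Copin, S. Smirnov, *Conformal invariance of lattice models*, Clay Math. Proc. 15
  (2012), §3.2 and Thm. 3.16.
-/

noncomputable section

open MeasureTheory Finset SimpleGraph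
open Literature.Probability.Percolation

namespace Literature.Probability.LatticeModels

/-! ### Generic invariance under a graph isomorphism -/

section Iso

variable {V W : Type*}

/-- A bijection of the vertices carrying `ω` to `φ '' ω` and `B` to `φ(B)` is an isomorphism of the
wired open graphs `⟨ω⟩ ∨ K_B ≃g ⟨φ ω⟩ ∨ K_{φ B}`. [folklore] -/
def wiredOpenGraphRelabelIso (φ : V ≃ W) (ω : Percolation.BondConfig V) (B : Set V) :
    Percolation.openGraph ω ⊔ wired B ≃g
      Percolation.openGraph (BondConfig.relabel (sym2Equiv φ) ω) ⊔ wired (φ '' B) where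
  toEquiv := φ
  map_rel_iff' := by
    intro a b
    rw [sup_adj, sup_adj, openGraph_relabel_adj_iff, wired_adj, wired_adj,
      φ.injective.mem_set_image, φ.injective.mem_set_image, φ.injective.ne_iff]

/-- **Cluster counts are invariant under relabelling**: `k^{φ B}(φ ω) = k^B(ω)`.
[cite: Grimmett2006, §4.3] -/
theorem clusterCount_relabel (φ : V ≃ W) (ω : Percolation.BondConfig V) (B : Set V) :
    clusterCount (BondConfig.relabel (sym2Equiv φ) ω) (φ '' B) = clusterCount ω B := by
  unfold clusterCount
  exact (Nat.card_congr (wiredOpenGraphRelabelIso φ ω B).connectedComponentEquiv).symm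

variable [Fintype V] [DecidableEq V] [Fintype W] [DecidableEq W]
  {G : SimpleGraph V} {G' : SimpleGraph W} [DecidableRel G.Adj] [DecidableRel G'.Adj]

omit [DecidableEq V] [DecidableEq W] in
/-- The edge map of an isomorphism, on finite edge sets: `φ(E(G)) = E(G')`. [folklore] -/
theorem map_edgeFinset_iso (φ : G ≃g G') :
    G.edgeFinset.map (sym2Equiv φ.toEquiv).toEmbedding = G'.edgeFinset := by
  ext z
  rw [Finset.mem_map_equiv, mem_edgeFinset, mem_edgeFinset, ← sym2Equiv_mem_edgeSet_iff φ,
    Equiv.apply_symm_apply]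

omit [Fintype V] [DecidableEq V] [Fintype W] [DecidableEq W] in
/-- The relabelled configuration of a finite edge set is the mapped edge set. [folklore] -/
theorem relabel_coe_eq_coe_map (φ : V ≃ W) (ω : Finset (Sym2 V)) :
    BondConfig.relabel (sym2Equiv φ) (↑ω : Percolation.BondConfig V) =
      ↑(ω.map (sym2Equiv φ).toEmbedding) := by
  rw [BondConfig.relabel_apply, Finset.coe_map]
  rfl

omit [DecidableEq V] [DecidableEq W] in
/-- Reindexing sums over configurations along an isomorphism: `ω ↦ φ ω` is a bijection from the
edge sets of `G` onto the edge sets of `G'`. [folklore] -/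
theorem sum_powerset_map_iso {M : Type*} [AddCommMonoid M] (φ : G ≃g G') (F : Finset (Sym2 W) → M) :
    ∑ ω ∈ G.edgeFinset.powerset, F (ω.map (sym2Equiv φ.toEquiv).toEmbedding) =
      ∑ ω' ∈ G'.edgeFinset.powerset, F ω' := by
  refine Finset.sum_nbij (fun ω => ω.map (sym2Equiv φ.toEquiv).toEmbedding) (fun ω hω => ?_)
    (fun ω₁ _ ω₂ _ h => Finset.map_injective _ h) (fun ω' hω' => ?_) (fun _ _ => rfl)
  · rw [Finset.mem_powerset] at hω ⊢
    rw [← map_edgeFinset_iso φ]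
    exact Finset.map_subset_map.2 hω
  · rw [Finset.mem_coe, Finset.mem_powerset] at hω'
    refine ⟨ω'.map (sym2Equiv φ.symm.toEquiv).toEmbedding, ?_, ?_⟩
    · rw [Finset.mem_coe, Finset.mem_powerset]
      intro z hz
      rw [Finset.mem_map_equiv] at hz
      rw [mem_edgeFinset, ← sym2Equiv_mem_edgeSet_iff φ]
      exact mem_edgeFinset.1 (hω' hz)
    · ext z
      rw [Finset.mem_map_equiv, Finset.mem_map_equiv]
      exact Iff.of_eq (congrArg (· ∈ ω') (Equiv.apply_symm_apply (sym2Equiv φ.toEquiv) z))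

/-- **Random-cluster weights are invariant under graph isomorphisms.** [cite: Grimmett2006, §1.2 eq. (1.2) and §4.3] -/
theorem rcWeight_relabel (φ : G ≃g G') (p q : ℝ) (B : Set V) (ω : Finset (Sym2 V)) :
    rcWeight G' p q (φ '' B) (ω.map (sym2Equiv φ.toEquiv).toEmbedding) = rcWeight G p q B ω := by
  unfold rcWeight
  rw [Finset.card_map, ← map_edgeFinset_iso φ, ← Finset.map_sdiff, Finset.card_map,
    ← relabel_coe_eq_coe_map, show ((φ : V → W) '' B) = (φ.toEquiv : V → W) '' B from rfl,
    clusterCount_relabel]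

/-- **Partition functions are invariant under graph isomorphisms.** [cite: Grimmett2006, §1.2 eq. (1.3) and §4.3] -/
theorem rcPartitionFunction_relabel (φ : G ≃g G') (p q : ℝ) (B : Set V) :
    rcPartitionFunction G' p q (φ '' B) = rcPartitionFunction G p q B := by
  unfold rcPartitionFunction
  rw [← sum_powerset_map_iso φ]
  exact Finset.sum_congr rfl fun ω _ => rcWeight_relabel φ p q B ω

/-- **The random-cluster measure is invariant under graph isomorphisms** (Grimmett 2006, §4.3):
for `φ : G ≃g G'` and every event `A` of `G'`-configurations,
`φ^B_{G,p,q}{ω | φ ω ∈ A} = φ^{φ B}_{G',p,q}(A)`. [cite: Grimmett2006, §4.3] -/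
theorem rcMeasure_real_preimage_relabel (φ : G ≃g G') {p q : ℝ} (hp : p ∈ Set.Icc (0 : ℝ) 1)
    (hq : 0 < q) (B : Set V) (A : Set (Percolation.BondConfig W)) :
    (rcMeasure G p q B).real (BondConfig.relabel (sym2Equiv φ.toEquiv) ⁻¹' A) =
      (rcMeasure G' p q (φ '' B)).real A := by
  classical
  rw [rcMeasure_real_apply G hp hq B, rcMeasure_real_apply G' hp hq (φ '' B) A,
    ← sum_powerset_map_iso φ, rcPartitionFunction_relabel φ p q B]
  refine Finset.sum_congr rfl fun ω _ => ?_
  simp only [Set.mem_preimage, relabel_coe_eq_coe_map, rcWeight_relabel φ p q B ω]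

/-- The same invariance with the event written on the source side: for an event `A` of
`G`-configurations, `φ^{φ B}_{G',p,q}{ω' | φ⁻¹ ω' ∈ A} = φ^B_{G,p,q}(A)`. [cite: Grimmett2006, §4.3] -/
theorem rcMeasure_real_preimage_relabel_symm (φ : G ≃g G') {p q : ℝ} (hp : p ∈ Set.Icc (0 : ℝ) 1)
    (hq : 0 < q) (B : Set V) (A : Set (Percolation.BondConfig V)) :
    (rcMeasure G' p q (φ '' B)).real (BondConfig.relabel (sym2Equiv φ.symm.toEquiv) ⁻¹' A) =
      (rcMeasure G p q B).real A := by
  rw [← rcMeasure_real_preimage_relabel φ hp hq B]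
  congr 1
  ext ω
  simp only [Set.mem_preimage]
  rw [show φ.symm.toEquiv = φ.toEquiv.symm from rfl, relabel_symm_relabel]

/-- Images of events: `φ^{φ B}_{G',p,q}(φ(A)) = φ^B_{G,p,q}(A)` (the image of `A` under
`ω ↦ φ ω`). [cite: Grimmett2006, §4.3] -/
theorem rcMeasure_real_image_relabel (φ : G ≃g G') {p q : ℝ} (hp : p ∈ Set.Icc (0 : ℝ) 1)
    (hq : 0 < q) (B : Set V) (A : Set (Percolation.BondConfig V)) :
    (rcMeasure G' p q (φ '' B)).real (BondConfig.relabel (sym2Equiv φ.toEquiv) '' A) =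
      (rcMeasure G p q B).real A := by
  rw [← rcMeasure_real_preimage_relabel_symm φ hp hq B A]
  congr 1
  rw [show (BondConfig.relabel (sym2Equiv φ.toEquiv) '' A) =
    (BondConfig.relabel (sym2Equiv φ.toEquiv)).toEquiv '' A from rfl, Equiv.image_eq_preimage_symm]
  rfl

end Iso

/-! ### Restricting an automorphism of the ambient graph to finite pieces -/

section FinsetIso

variable {V : Type*} {G : SimpleGraph V}

/-- An automorphism `g` of `G` with `g(S) = S'` restricts to an isomorphism of the finite pieces
`finsetGraph G S ≃g finsetGraph G S'`. [folklore] -/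
def finsetGraphIso (g : G ≃g G) {S S' : Finset V} (h : ∀ x, x ∈ S' ↔ g.symm x ∈ S) :
    finsetGraph G S ≃g finsetGraph G S' where
  toEquiv :=
    { toFun := fun x => ⟨g x, (h _).2 (by rw [RelIso.symm_apply_apply]; exact x.2)⟩
      invFun := fun y => ⟨g.symm y, (h y).1 y.2⟩
      left_inv := fun x => Subtype.ext (RelIso.symm_apply_apply g x)
      right_inv := fun y => Subtype.ext (RelIso.apply_symm_apply g y) }
  map_rel_iff' := by
    intro a b
    exact g.map_rel_iff

/-- The restricted isomorphism acts by `g` on the underlying vertices. [folklore] -/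
@[simp] theorem finsetGraphIso_apply_coe (g : G ≃g G) {S S' : Finset V}
    (h : ∀ x, x ∈ S' ↔ g.symm x ∈ S) (x : S) : (finsetGraphIso g h x : V) = g x := rfl

/-- Images of value-defined vertex sets: `{x ∈ S | P x} ↦ {y ∈ S' | P (g⁻¹ y)}`. [folklore] -/
theorem image_finsetGraphIso_setOf (g : G ≃g G) {S S' : Finset V}
    (h : ∀ x, x ∈ S' ↔ g.symm x ∈ S) (P : V → Prop) :
    (finsetGraphIso g h) '' {x : S | P x.1} = {y : S' | P (g.symm y.1)} := by
  ext y
  constructor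
  · rintro ⟨x, hx, rfl⟩
    simpa [finsetGraphIso] using hx
  · intro hy
    refine ⟨⟨g.symm y.1, (h _).1 y.2⟩, hy, Subtype.ext ?_⟩
    simp [finsetGraphIso]

/-- The restricted isomorphism maps the wired boundary `∂S` onto `∂S'` (an automorphism of the
ambient graph preserves "having a neighbour outside"). [folklore] -/
theorem image_finsetGraphIso_wiredBoundary [DecidableEq V] [G.LocallyFinite] (g : G ≃g G)
    {S S' : Finset V} (h : ∀ x, x ∈ S' ↔ g.symm x ∈ S) :
    (finsetGraphIso g h) '' wiredBoundary G S = wiredBoundary G S' := by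
  ext y
  simp only [Set.mem_image, mem_wiredBoundary_iff, mem_innerBoundary_iff]
  constructor
  · rintro ⟨x, ⟨-, z, hz, hxz⟩, rfl⟩
    refine ⟨((finsetGraphIso g h) x).2, g z, fun hz' => hz ?_, ?_⟩
    · have := (h _).1 hz'
      rwa [RelIso.symm_apply_apply] at this
    · exact g.map_rel_iff.2 hxz
  · rintro ⟨hy, z, hz, hyz⟩
    refine ⟨⟨g.symm y.1, (h _).1 y.2⟩, ⟨(h _).1 y.2, g.symm z, fun hz' => hz ?_, ?_⟩,
      Subtype.ext (by simp [finsetGraphIso])⟩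
    · have := (h (g (g.symm z))).2 (by rw [RelIso.symm_apply_apply]; exact hz')
      rwa [RelIso.apply_symm_apply] at this
    · have := (g.symm.map_rel_iff).2 hyz
      exact this

/-- `image_finsetGraphIso_setOf` with the vertex types written `↥(S : Set V)` (the form used by
`fkIsingFiniteMeasure`). [folklore] -/
theorem image_finsetGraphIso_setOf' (g : G ≃g G) {S S' : Finset V}
    (h : ∀ x, x ∈ S' ↔ g.symm x ∈ S) (P : V → Prop) :
    (finsetGraphIso g h) '' ({x | P x.1} : Set ↥(S : Set V)) =
      ({y | P (g.symm y.1)} : Set ↥(S' : Set V)) :=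
  image_finsetGraphIso_setOf g h P

/-- `ψ(univ) = univ`, with the vertex types written `↥(S : Set V)`. [folklore] -/
theorem image_finsetGraphIso_univ' (g : G ≃g G) {S S' : Finset V}
    (h : ∀ x, x ∈ S' ↔ g.symm x ∈ S) :
    (finsetGraphIso g h) '' (Set.univ : Set ↥(S : Set V)) = (Set.univ : Set ↥(S' : Set V)) :=
  Set.image_univ_of_surjective (finsetGraphIso g h).surjective

end FinsetIso

/-! ### The critical FK-Ising measure of a finite piece of `ℤ²` under the symmetries of `ℤ²` -/

section Lattice

/-- The measure `fkIsingFiniteMeasure S B` of `FKIsingRSW.lean` (stated with `(zdGraph 2).induce ↑S`)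
is the random-cluster measure of `finsetGraph (zdGraph 2) S` (`RandomClusterDomainMarkov.lean`):
the two graphs are the same object, only the decidability instances differ. [folklore] -/
theorem fkIsingFiniteMeasure_eq_finsetGraph (S : Finset (Site 2)) (B : Set ↥(S : Set (Site 2))) :
    fkIsingFiniteMeasure S B = rcMeasure (finsetGraph (zdGraph 2) S) criticalFKIsingParam 2 B := by
  unfold fkIsingFiniteMeasure
  congr 1

/-- **Invariance of the critical FK-Ising measures under the symmetries of `ℤ²`**: if the lattice
automorphism `g` maps `S` onto `S'`, then for the induced isomorphism `ψ = finsetGraphIso g h`,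
`φ^{ψ B}_{S'}(ψ A) = φ^B_S(A)` for every event `A`. (Duminil-Copin–Smirnov 2012, §3.2:
"translation invariance of the model makes the position … irrelevant".) [cite: Grimmett2006, §4.3] -/
theorem fkIsingFiniteMeasure_real_image_relabel (g : zdGraph 2 ≃g zdGraph 2) {S S' : Finset (Site 2)}
    (h : ∀ x, x ∈ S' ↔ g.symm x ∈ S) (B : Set ↥(S : Set (Site 2)))
    (A : Set (Percolation.BondConfig ↥(S : Set (Site 2)))) :
    (fkIsingFiniteMeasure S' ((finsetGraphIso g h) '' B)).real
        (BondConfig.relabel (sym2Equiv (finsetGraphIso g h).toEquiv) '' A) =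
      (fkIsingFiniteMeasure S B).real A := by
  rw [fkIsingFiniteMeasure_eq_finsetGraph, fkIsingFiniteMeasure_eq_finsetGraph]
  exact rcMeasure_real_image_relabel (finsetGraphIso g h) criticalFKIsingParam_mem_Icc two_pos B A

/-- The same for open crossing events, which are transported to open crossing events
(`preimage_relabel_openCrossing`): `φ^{ψ B}_{S'}(C(ψ T; ψ A₁, ψ A₂)) = φ^B_S(C(T; A₁, A₂))`.
[cite: Grimmett2006, §4.3] -/
theorem fkIsingFiniteMeasure_real_openCrossing_image (g : zdGraph 2 ≃g zdGraph 2)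
    {S S' : Finset (Site 2)} (h : ∀ x, x ∈ S' ↔ g.symm x ∈ S) (B : Set ↥(S : Set (Site 2)))
    (T A₁ A₂ : Set ↥(S : Set (Site 2))) :
    (fkIsingFiniteMeasure S' ((finsetGraphIso g h) '' B)).real
        (openCrossing ((finsetGraphIso g h) '' T) ((finsetGraphIso g h) '' A₁)
          ((finsetGraphIso g h) '' A₂)) =
      (fkIsingFiniteMeasure S B).real (openCrossing T A₁ A₂) := by
  rw [fkIsingFiniteMeasure_eq_finsetGraph, fkIsingFiniteMeasure_eq_finsetGraph,
    ← rcMeasure_real_preimage_relabel (finsetGraphIso g h) criticalFKIsingParam_mem_Icc two_pos B]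
  exact congrArg _ (preimage_relabel_openCrossing (finsetGraphIso g h).toEquiv T A₁ A₂)

/-- Free boundary conditions are preserved: `ψ(∅) = ∅`. [folklore] -/
theorem fkIsingFiniteMeasure_real_openCrossing_image_free (g : zdGraph 2 ≃g zdGraph 2)
    {S S' : Finset (Site 2)} (h : ∀ x, x ∈ S' ↔ g.symm x ∈ S) (T A₁ A₂ : Set ↥(S : Set (Site 2))) :
    (fkIsingFiniteMeasure S' ∅).real
        (openCrossing ((finsetGraphIso g h) '' T) ((finsetGraphIso g h) '' A₁)
          ((finsetGraphIso g h) '' A₂)) =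
      (fkIsingFiniteMeasure S ∅).real (openCrossing T A₁ A₂) := by
  have := fkIsingFiniteMeasure_real_openCrossing_image g h ∅ T A₁ A₂
  rwa [Set.image_empty] at this

end Lattice

/-! ### DCS Theorem 3.16 in translated and transposed rectangles -/

section RSW

/-- The inverse of the translation by `v` is the translation by `-v`. [folklore] -/
theorem zdShiftIso_symm_apply (v x : Site 2) : (zdShiftIso v).symm x = x - v :=
  Site.shift_symm_apply v x

/-- The inverse of "transpose, then translate by `v`" is "translate by `-v`, then transpose".
[folklore] -/
theorem transpose_trans_shift_symm_apply (v x : Site 2) :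
    (transposeIso.trans (zdShiftIso v)).symm x = ![x 1 - v 1, x 0 - v 0] := by
  change transposeIso.symm ((zdShiftIso v).symm x) = _
  rw [zdShiftIso_symm_apply, transposeIso_symm_apply, transposeIso_apply]
  rfl

/-- **DCS Thm. 3.16 for translated rectangles** (from the named fact `fkIsing_rsw` by translation
invariance, `fkIsingFiniteMeasure_real_openCrossing_image` with `zdShiftIso v`): with the constant
`c > 0` of `fkIsing_rsw`, for every `n ≥ 1`, every `v ∈ ℤ²` and the lattice rectangle
`S' = v + [0, 4n] × [0, n]`, the critical FK-Ising measure of `S'` with free boundary conditions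
gives probability `≥ c` to an open crossing of `S'` from its left side `{x₀ = v₀}` to its right
side `{x₀ = v₀ + 4n}`. [cite: DuminilCopinSmirnov2012Clay, Thm. 3.16] -/
theorem fkIsing_rsw.shift (hrsw : fkIsing_rsw) :
    ∃ c : ℝ, 0 < c ∧ ∀ n : ℕ, 1 ≤ n → ∀ (v : Site 2) (S' : Finset (Site 2)),
      (∀ x, x ∈ S' ↔ x - v ∈ rectangle (4 * n) n) →
      c ≤ (fkIsingFiniteMeasure S' ∅).real
        (openCrossing Set.univ {x | x.1 0 = v 0} {x | x.1 0 = v 0 + 4 * n}) := by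
  obtain ⟨c, hc, h⟩ := hrsw
  refine ⟨c, hc, fun n hn v S' hS' => ?_⟩
  have h' : ∀ x, x ∈ S' ↔ (zdShiftIso v).symm x ∈ rectangle (4 * n) n := fun x => by
    rw [zdShiftIso_symm_apply]; exact hS' x
  have key := fkIsingFiniteMeasure_real_openCrossing_image_free (zdShiftIso v) h' Set.univ
    {x | x.1 0 = 0} {x | x.1 0 = ((4 * n : ℕ) : ℤ)}
  rw [image_finsetGraphIso_univ', image_finsetGraphIso_setOf' (zdShiftIso v) h' (fun x => x 0 = 0),
    image_finsetGraphIso_setOf' (zdShiftIso v) h' (fun x => x 0 = ((4 * n : ℕ) : ℤ))] at key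
  refine (h n hn).trans (le_of_eq ?_)
  rw [← key]
  congr 3
  · ext y; simp only [zdShiftIso_symm_apply, Pi.sub_apply]; omega
  · ext y; simp only [zdShiftIso_symm_apply, Pi.sub_apply]; push_cast; omega

/-- **DCS Thm. 3.16, transposed** (by the symmetry of `ℤ²` exchanging the axes, `transposeIso`,
composed with a translation): with the same constant `c > 0`, for every `n ≥ 1`, every `v ∈ ℤ²`
and the lattice rectangle `S' = v + [0, n] × [0, 4n]` (`n` wide, `4n` tall), the critical FK-Ising
measure of `S'` with free boundary conditions gives probability `≥ c` to an open crossing of `S'`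
from its bottom side `{x₁ = v₁}` to its top side `{x₁ = v₁ + 4n}` (the hard direction).
[cite: DuminilCopinSmirnov2012Clay, Thm. 3.16] -/
theorem fkIsing_rsw.transpose_shift (hrsw : fkIsing_rsw) :
    ∃ c : ℝ, 0 < c ∧ ∀ n : ℕ, 1 ≤ n → ∀ (v : Site 2) (S' : Finset (Site 2)),
      (∀ x, x ∈ S' ↔ (![x 1 - v 1, x 0 - v 0] : Site 2) ∈ rectangle (4 * n) n) →
      c ≤ (fkIsingFiniteMeasure S' ∅).real
        (openCrossing Set.univ {x | x.1 1 = v 1} {x | x.1 1 = v 1 + 4 * n}) := by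
  obtain ⟨c, hc, h⟩ := hrsw
  refine ⟨c, hc, fun n hn v S' hS' => ?_⟩
  set g : zdGraph 2 ≃g zdGraph 2 := transposeIso.trans (zdShiftIso v) with hg
  have h' : ∀ x, x ∈ S' ↔ g.symm x ∈ rectangle (4 * n) n := fun x => by
    rw [hg, transpose_trans_shift_symm_apply]; exact hS' x
  have key := fkIsingFiniteMeasure_real_openCrossing_image_free g h' Set.univ
    {x | x.1 0 = 0} {x | x.1 0 = ((4 * n : ℕ) : ℤ)}
  rw [image_finsetGraphIso_univ', image_finsetGraphIso_setOf' g h' (fun x => x 0 = 0),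
    image_finsetGraphIso_setOf' g h' (fun x => x 0 = ((4 * n : ℕ) : ℤ))] at key
  refine (h n hn).trans (le_of_eq ?_)
  rw [← key]
  congr 3
  · ext y
    simp only [hg, transpose_trans_shift_symm_apply, Matrix.cons_val_zero]
    omega
  · ext y
    simp only [hg, transpose_trans_shift_symm_apply, Matrix.cons_val_zero]
    push_cast; omega

end RSW

end Literature.Probability.LatticeModels
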